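import Summits.ABC.IUTFork.Cor312PilotKummerSplitModel
import Summits.ABC.IUTFork.Cor312IdentifiedCopies
import HarnessLib

/-!
# [IUTchIII] Cor. 3.12 — the SPLIT natural model P♮₁ of the residual `S`, III: typed Thm. 3.11 and the two volumes

Proof-only file (D-0012; no definition, no `Prop` fact) of the abc-iut cell (wave 5, seat abc-iut-w5-d230 gen 4; by-name support piece for
the IUT REPAIR branch), sequel of `Cor312PilotKummerSplitShells` / `Cor312PilotKummerSplitModel` (the model data P♮₁: split packets, boxes,
capsule permutations). TAKES NO SIDE on [IUTchIII] Cor. 3.12. PROVED HERE: §7 the log-volume `splitVol` is MONOTONE and INVARIANT under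
every family acting by capsule permutations — hence under the whole group ⟨(Ind1)∪(Ind2)⟩ — (deep sets are transported, `deepSet_image_of_perm`;
Step (x) `LogvolInvariant` holds NON-trivially); §8 the Θ-point's coordinates (`coord_thetaPt`: `2^j` through the bad summand of the last factor,
`0` otherwise), so its box is `box (DTheta j)` and the deep set of that box is EXACTLY `DTheta j`; §9 the typed [IUTchIII] Theorem 3.11
(i) ∧ (ii) ∧ (iii) HOLDS (`splitFull_statement`; `PsiInSubPackets` honestly: the Θ-point lies in the sub-packet `𝓘^ℚ(^{S^±_{j+1},j};−)_v`);
§10 the pilots are the objects of exponent `1`, the Θ-region is `box (DTheta j)`, the q-region its (Ind1)-translate `box (permD (swapLast j)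
(DTheta j))` — a possible image —, every possible image is a capsule-permutation translate of the Θ-box, the hull `ⁿ˒°𝒰` is the box of the
COMMON deep coordinates, whose deep set is STRICTLY smaller than `DTheta j` (the coordinate `c₀ = 𝟙_{i=0}` separates), so at every label of
`𝔽_l^⋇` the hull has STRICTLY larger volume than the q-region; `|log(q)| > 0`, and the printed Statement STRICT
(`splitSetting_statement_strict`). Pins / `S` / package: part IV. Interface-level toy of the (Ind1) MECHANISM ([IUTchIV] Thm. 1.10 Step (v)
«symmetrizing with respect to the choice of i†»; Dupuy–Hilado §4.7); [claim: Mochizuki2012, status: disputed] for every IUT noun.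
-/

noncomputable section

open Set

namespace Summit.ABC.IUTFork.Cor312Vol

namespace SplitWitness

open Thm311 Cor312 Cor312.IdentifiedNonVacuity NaiveWitness PinnedWitness Literature.IUT.LogThetaLattice

/-! ## 7. The log-volume: monotone, permutation-invariant -/

/-- The deep set is antitone. [folklore] -/
theorem deepSet_antitone {j : splitIndex.Label} {vQ : splitIndex.VQ} {U U' : Set (splitShells.Packet j vQ)} (h : U ⊆ U') :
    deepSet U' ⊆ deepSet U := fun c hc => (mem_deepSet_iff U c).2 (h.trans ((mem_deepSet_iff U' c).1 hc))

/-- The log-volume is nonpositive. [folklore] -/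
theorem splitVol_nonpos {j : splitIndex.Label} {vQ : splitIndex.VQ} (U : Set (splitShells.Packet j vQ)) : splitVol j vQ U ≤ 0 := by
  unfold splitVol; split_ifs
  · have : (0 : ℝ) ≤ (deepSet U).card := Nat.cast_nonneg _
    linarith
  · exact le_rfl

/-- **The log-volume is MONOTONE** on all regions. [folklore] -/
theorem splitVol_mono {j : splitIndex.Label} {vQ : splitIndex.VQ} {U U' : Set (splitShells.Packet j vQ)} (h : U ⊆ U') :
    splitVol j vQ U ≤ splitVol j vQ U' := by
  by_cases h' : U' ⊆ box ∅
  · have hU : U ⊆ box ∅ := h.trans h'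
    unfold splitVol; rw [if_pos hU, if_pos h']
    have : ((deepSet U').card : ℝ) ≤ (deepSet U).card := by exact_mod_cast Finset.card_le_card (deepSet_antitone h)
    linarith
  · have e : splitVol j vQ U' = 0 := by unfold splitVol; rw [if_neg h']
    rw [e]; exact splitVol_nonpos U

/-- A family acting by `σ` carries the hull-set `box D` onto `box (permD σ D)`. [folklore] -/
theorem image_box_of_perm {Φ : splitShells.PacketAut} {j : splitIndex.Label} {vQ : splitIndex.VQ} {σ : Equiv.Perm (splitIndex.Caps j)}
    (hΦ : ∀ x, Φ j vQ x = splitShells.permute j vQ σ x) (D : Finset (splitIndex.Caps j → Bool)) :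
    Φ j vQ '' box D = box (permD σ D) :=
  image_boxLE_of_perm hΦ 1 D

/-- The inverse of a family acting by `σ` acts by `σ⁻¹`. [folklore] -/
theorem symm_apply_of_perm {Φ : splitShells.PacketAut} {j : splitIndex.Label} {vQ : splitIndex.VQ} {σ : Equiv.Perm (splitIndex.Caps j)}
    (hΦ : ∀ x, Φ j vQ x = splitShells.permute j vQ σ x) (y : splitShells.Packet j vQ) :
    (Φ j vQ).symm y = splitShells.permute j vQ σ.symm y := by
  rw [show Φ j vQ = splitShells.permute j vQ σ from LinearEquiv.ext hΦ]
  show (PiTensorProduct.reindex ℚ (fun _ : splitIndex.Caps j => splitShells.Packet1 vQ) σ).symm y = _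
  rw [PiTensorProduct.reindex_symm]; rfl

/-- `Φ '' U ⊆ box D ↔ U ⊆ box (permD σ⁻¹ D)` for a family acting by `σ`. [folklore] -/
theorem image_subset_box_iff {Φ : splitShells.PacketAut} {j : splitIndex.Label} {vQ : splitIndex.VQ} {σ : Equiv.Perm (splitIndex.Caps j)}
    (hΦ : ∀ x, Φ j vQ x = splitShells.permute j vQ σ x) (U : Set (splitShells.Packet j vQ)) (D : Finset (splitIndex.Caps j → Bool)) :
    Φ j vQ '' U ⊆ box D ↔ U ⊆ box (permD σ.symm D) := by
  rw [Set.image_subset_iff, ← LinearEquiv.image_symm_eq_preimage]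
  have h := image_boxLE_of_perm (Φ := Φ⁻¹) (j := j) (vQ := vQ) (σ := σ.symm) (fun x => symm_apply_of_perm hΦ x) 1 D
  show U ⊆ (Φ j vQ).symm '' box D ↔ _
  rw [show ((Φ j vQ).symm : splitShells.Packet j vQ → splitShells.Packet j vQ) '' box D = Φ⁻¹ j vQ '' boxLE 1 D from rfl, h]
  rfl

/-- **Deep sets are transported**: `deepSet (σ·U) = permD σ (deepSet U)`. [folklore] -/
theorem deepSet_image_of_perm {Φ : splitShells.PacketAut} {j : splitIndex.Label} {vQ : splitIndex.VQ} {σ : Equiv.Perm (splitIndex.Caps j)}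
    (hΦ : ∀ x, Φ j vQ x = splitShells.permute j vQ σ x) (U : Set (splitShells.Packet j vQ)) :
    deepSet (Φ j vQ '' U) = permD σ (deepSet U) := by
  ext c
  rw [mem_deepSet_iff, mem_permD_iff, mem_deepSet_iff, image_subset_box_iff hΦ]
  have : permD σ.symm ({c} : Finset (splitIndex.Caps j → Bool)) = {c ∘ ⇑σ} := by
    unfold permD; rw [Finset.image_singleton]; simp
  rw [this]

/-- A transported deep set has the same cardinality. [folklore] -/
theorem card_permD {j : splitIndex.Label} (σ : Equiv.Perm (splitIndex.Caps j)) (D : Finset (splitIndex.Caps j → Bool)) :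
    (permD σ D).card = D.card :=
  Finset.card_image_of_injective _ fun c c' (h : c ∘ ⇑σ.symm = c' ∘ ⇑σ.symm) => by
    funext i; have := congrFun h (σ i); simpa using this

/-- **The log-volume is INVARIANT under every family acting by capsule permutations** — in particular under every element of
⟨(Ind1)∪(Ind2)⟩ (`actsByPerm_of_mem_closure`): Step (x) of the printed proof in P♮₁, non-trivially. [folklore] -/
theorem splitVol_image_of_perm {Φ : splitShells.PacketAut} {j : splitIndex.Label} {vQ : splitIndex.VQ} {σ : Equiv.Perm (splitIndex.Caps j)}
    (hΦ : ∀ x, Φ j vQ x = splitShells.permute j vQ σ x) (U : Set (splitShells.Packet j vQ)) :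
    splitVol j vQ (Φ j vQ '' U) = splitVol j vQ U := by
  have h0 : Φ j vQ '' U ⊆ box ∅ ↔ U ⊆ box ∅ := by
    rw [image_subset_box_iff hΦ]; unfold permD; rw [Finset.image_empty]
  unfold splitVol
  by_cases hU : U ⊆ box ∅
  · rw [if_pos (h0.2 hU), if_pos hU, deepSet_image_of_perm hΦ, card_permD]
  · rw [if_neg (fun h => hU (h0.1 h)), if_neg hU]

/-- `LogvolInvariant` of the data of P♮₁ (abc-iut-c312-1's Step (x) side condition), PROVED. [folklore] -/
theorem splitData_logvolInvariant : splitData.LogvolInvariant := fun Φ hΦ j vQ A _ => by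
  have hp : ActsByPerm Φ := by
    rcases hΦ with h1 | h2
    · exact actsByPerm_of_mem_Ind1Family h1
    · exact actsByPerm_of_mem_Ind2Family h2
  obtain ⟨σ, hσ⟩ := hp j vQ
  exact splitVol_image_of_perm hσ A

/-! ## 8. The Θ-point: coordinates, box, deep set -/

/-- **The coordinates of the Θ-point**: `coord c (thetaPt) = 2^j` if `c` passes through the bad summand of the last factor (`c(j) = true`),
`0` otherwise. [folklore] -/
theorem coord_thetaPt (j : splitIndex.Label) (vQ : splitIndex.VQ) (c : splitIndex.Caps j → Bool) :
    coord j vQ c (thetaPt j vQ) = 2 ^ (j : ℕ) * (if c (Fin.last _) = true then 1 else 0) := by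
  unfold thetaPt LogShells.tprod
  rw [coord_tprod, Fin.prod_univ_castSucc]
  have h1 : ∀ i : Fin (j : ℕ), thetaFn j vQ (Fin.castSucc i) (fib vQ (c (Fin.castSucc i))) = 2 := fun i => by
    unfold thetaFn; rw [if_neg (Fin.castSucc_lt_last i).ne]
  have h2 : thetaFn j vQ (Fin.last _) (fib vQ (c (Fin.last _))) = if c (Fin.last _) = true then 1 else 0 := by
    unfold thetaFn; rw [if_pos rfl]; rfl
  simp only [h1, h2]
  show (∏ _i : Fin (j : ℕ), (2 : ℚ)) * _ = _
  rw [Fin.prod_const]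

/-- The Θ-point is shallow-bounded: `|coord c (thetaPt)| ≤ 8` (as `j ≤ 2`). [folklore] -/
theorem abs_coord_thetaPt_le (j : splitIndex.Label) (vQ : splitIndex.VQ) (c : splitIndex.Caps j → Bool) :
    |coord j vQ c (thetaPt j vQ)| ≤ 8 := by
  rw [coord_thetaPt]
  have hj : (j : ℕ) ≤ 2 := Nat.lt_succ_iff.1 j.2
  have h4 : (2 : ℚ) ^ (j : ℕ) ≤ 2 ^ 2 := pow_le_pow_right₀ (by norm_num) hj
  split_ifs
  · rw [mul_one, abs_of_nonneg (by positivity)]; linarith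
  · rw [mul_zero, abs_zero]; norm_num

/-- At a label `j ≥ 1`: `|coord c (thetaPt)| ≤ 1 ↔ c(j) = false`. [folklore] -/
theorem abs_coord_thetaPt_le_one_iff {j : splitIndex.Label} (hj : j ≠ 0) (vQ : splitIndex.VQ) (c : splitIndex.Caps j → Bool) :
    |coord j vQ c (thetaPt j vQ)| ≤ 1 ↔ c (Fin.last _) = false := by
  rw [coord_thetaPt]
  have hj1 : 1 ≤ (j : ℕ) := Nat.one_le_iff_ne_zero.2 fun h => hj (Fin.ext h)
  have h2 : (2 : ℚ) ≤ 2 ^ (j : ℕ) := by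
    calc (2 : ℚ) = 2 ^ 1 := by norm_num
      _ ≤ 2 ^ (j : ℕ) := pow_le_pow_right₀ (by norm_num) hj1
  constructor
  · intro h
    by_contra hc
    rw [if_pos (by simpa using hc), mul_one, abs_of_nonneg (by positivity)] at h
    linarith
  · intro h
    rw [h]; simp

/-- The Θ-point lies in `box D` iff `D ⊆ DTheta j` (labels `j ≥ 1`). [folklore] -/
theorem thetaPt_mem_box_iff {j : splitIndex.Label} (hj : j ≠ 0) (vQ : splitIndex.VQ) (D : Finset (splitIndex.Caps j → Bool)) :
    thetaPt j vQ ∈ (box D : Set (splitShells.Packet j vQ)) ↔ D ⊆ DTheta j := by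
  constructor
  · intro h c hc
    unfold DTheta; rw [Finset.mem_filter]
    exact ⟨Finset.mem_univ _, (abs_coord_thetaPt_le_one_iff hj vQ c).1 (h.2 c hc)⟩
  · intro h
    refine ⟨fun c => abs_coord_thetaPt_le vQ (j := j) c, fun c hc => (abs_coord_thetaPt_le_one_iff hj vQ c).2 ?_⟩
    have := h hc; unfold DTheta at this; rw [Finset.mem_filter] at this; exact this.2

/-- **The deep set of the Θ-box is EXACTLY `DTheta j`** (labels `j ≥ 1`; the Θ-point separates). [folklore] -/
theorem deepSet_box_DTheta {j : splitIndex.Label} (hj : j ≠ 0) (vQ : splitIndex.VQ) :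
    deepSet (box (DTheta j) : Set (splitShells.Packet j vQ)) = DTheta j := by
  ext c
  rw [mem_deepSet_iff]
  constructor
  · intro h
    have h1 : thetaPt j vQ ∈ (box {c} : Set (splitShells.Packet j vQ)) := h ((thetaPt_mem_box_iff hj vQ _).2 subset_rfl)
    exact (thetaPt_mem_box_iff hj vQ {c}).1 h1 (Finset.mem_singleton_self c)
  · intro hc; exact box_antitone (Finset.singleton_subset_iff.2 hc)

/-- The generated box of the Θ-point is the Θ-box `box (DTheta j)` (labels `j ≥ 1`). [folklore] -/
theorem pointBox_thetaPt {j : splitIndex.Label} (hj : j ≠ 0) (vQ : splitIndex.VQ) : pointBox (thetaPt j vQ) = box (DTheta j) := by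
  classical
  unfold pointBox DTheta
  congr 1
  ext c
  simp only [Finset.mem_filter, Finset.mem_univ, true_and]
  exact abs_coord_thetaPt_le_one_iff hj vQ c

/-- The volume of the Θ-box: `−1 − #DTheta j`. [folklore] -/
theorem splitVol_box_DTheta {j : splitIndex.Label} (hj : j ≠ 0) (vQ : splitIndex.VQ) :
    splitVol j vQ (box (DTheta j)) = -1 - ((DTheta j).card : ℝ) := by
  unfold splitVol; rw [if_pos (box_antitone (Finset.empty_subset _)), deepSet_box_DTheta hj]

/-! ## 9. The typed Theorem 3.11 (i) ∧ (ii) ∧ (iii) HOLDS for P♮₁ -/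

/-- The Θ-point lies in the SUB-PACKET `𝓘^ℚ(^{S^±_{j+1},j};−)_v` of the bad valuation: its last factor is supported on the summand `v = true`
([IUTchIII] Prop. 3.4 (ii): the splitting monoid «as a subset of ∏_j 𝓘^ℚ(^{S^±_{j+1},j};𝒟^⊢_v)»). [folklore] -/
theorem thetaPt_mem_subPacket (j : splitIndex.Label) : thetaPt j () ∈ splitShells.SubPacket j true := by
  refine Submodule.subset_span ⟨thetaFn j (), fun w hw => ?_, rfl⟩
  show thetaFn j () (Fin.last _) w = 0
  unfold thetaFn
  rw [if_pos rfl, if_neg]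
  exact fun h => hw h

/-- (i): the splitting monoid sits in the sub-packets (HONESTLY: theta value in the last factor on the bad summand); the degree clause (the
degree IS the global log-volume of the region); the classes `^{n,∘}𝔯^{LGP}` coincide. [folklore] -/
theorem split_partI : splitFull.PartI := by
  refine ⟨fun n v hv x hx j => ?_, fun n j k => ⟨fun vQ => trivial, Set.toFinite _, ?_⟩, fun _ _ => rfl⟩
  · have hv' : v = true := hv
    subst hv'
    rw [show x = thetaStar true from hx]
    exact thetaPt_mem_subPacket j.1
  · show splitVol j.1 () (box ∅) = ∑ᶠ vQ : splitIndex.VQ, splitVol j.1 vQ (box ∅)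
    rw [finsum_unique]

/-- (ii), column by column: identity Kummer transport, (Ind3) = `box ∅ ⊆ box ∅`, no archimedean place. [folklore] -/
theorem split_partII : splitFull.toLatticeSituation.PartII := fun _ =>
  (Column.partII_iff _ _).2
    ⟨fun _ _ _ _ _ => ⟨trivial, rfl⟩, fun _ _ _ => rfl, fun _ _ => rfl, fun _ _ _ _ _ => subset_rfl, fun _ _ _ h => absurd trivial h⟩

/-- (iii): the link data are abc-iut-w5-d247's `naiveLink`. [folklore] -/
theorem split_partIII : splitFull.PartIII := by
  refine ⟨naiveLink.partIIIa_holds, naiveLink.partIIIb_holds, ?_, fun n m => Thm311.PolyIsoCalc.stabilized_full _ _,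
    splitFull.evalCompatUpToInd_of_multiradialCompat split_partI.2.2⟩
  refine naiveLink.partIIIc_of_full (fun _ => rfl) fun n m => ?_
  rintro _ ⟨a, rfl⟩
  show unitIso a ≪≫ unitIso ((-1) ^ m.natAbs) = unitIso ((-1) ^ m.natAbs) ≪≫ unitIso a
  rw [unitIso_trans, unitIso_trans, mul_comm]

/-- **The typed Theorem 3.11 (i) ∧ (ii) ∧ (iii) HOLDS in P♮₁.** [folklore] -/
theorem splitFull_statement : splitFull.Statement := ⟨split_partI, split_partII, split_partIII⟩

/-! ## 10. Pilots, regions, possible images, hull; the two volumes; the Statement STRICT -/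

/-- The pilots are the objects of exponent `1`. [folklore] -/
theorem splitSetting_pilots : splitSetting.thetaPilot = (1 : ℤ) ∧ splitSetting.qPilot = (1 : ℤ) :=
  ⟨congrArg (Nat.cast : ℕ → ℤ)
    (expOf_eq_one_of_isGenerator_top (Classical.choose_spec (splitSetting.split.exists_gen true rfl))), rfl⟩

/-- The Kummer image of the Θ-pilot at every `(m, j, v_ℚ)` is `thetaRegionSplit 1`. [folklore] -/
theorem splitSetting_thetaRegion (m : ℤ) (j : splitIndex.Label) (vQ : splitIndex.VQ) :
    splitSetting.thetaRegion m j vQ = thetaRegionSplit 1 j vQ := by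
  unfold Setting.thetaRegion; rw [splitSetting_pilots.1]; rfl

/-- The (Ind3)-enlarged region is the same (no `m`-drift). [folklore] -/
theorem splitSetting_thetaRegion3 (j : splitIndex.Label) (vQ : splitIndex.VQ) :
    splitSetting.thetaRegion3 j vQ = thetaRegionSplit 1 j vQ := by
  show (⋃ m : ℤ, splitSetting.thetaRegion m j vQ) = _
  simp_rw [splitSetting_thetaRegion]; exact Set.iUnion_const _

/-- On `𝔽_l^⋇`: Θ-region `box (DTheta j)`, q-region `box (permD (swapLast j) (DTheta j))`. [folklore] -/
theorem splitSetting_regions_of_ne_zero {j : splitIndex.Label} (hj : j ≠ 0) (vQ : splitIndex.VQ) :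
    splitSetting.thetaRegion3 j vQ = box (DTheta j) ∧ splitSetting.qRegion j vQ = box (permD (swapLast j) (DTheta j)) := by
  rw [splitSetting_thetaRegion3, thetaRegionSplit_one_of_ne_zero hj]
  exact ⟨rfl, qRegionSplit_one_of_ne_zero hj vQ⟩

/-- `swapFamily` lies in the (Ind1)(Ind2)-group and acts on the packet at `j` by `swapLast j`. [folklore] -/
theorem swapFamily_mem_indGroup : swapFamily ∈ Setting.indGroup splitSituation ∧
    ∀ (j : splitIndex.Label) (vQ : splitIndex.VQ) x, swapFamily j vQ x = splitShells.permute j vQ (swapLast j) x :=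
  ⟨Subgroup.subset_closure (Or.inl (permFamily_mem_Ind1Family swapLast)), fun _ _ _ => rfl⟩

/-- **Every possible image of the Θ-pilot at a label of `𝔽_l^⋇` is a capsule-permutation translate `box (permD σ (DTheta j))` of the Θ-box**,
and the q-region is one of them (`σ = swapLast j`). [folklore] -/
theorem splitSetting_possibleImages {j : splitIndex.Label} (hj : j ≠ 0) (vQ : splitIndex.VQ) :
    (∀ U ∈ splitSetting.possibleImages j vQ, ∃ σ : Equiv.Perm (splitIndex.Caps j), U = box (permD σ (DTheta j))) ∧
      splitSetting.qRegion j vQ ∈ splitSetting.possibleImages j vQ := by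
  refine ⟨?_, ?_⟩
  · rintro U ⟨Φ, hΦ, rfl⟩
    obtain ⟨σ, hσ⟩ := actsByPerm_of_mem_closure hΦ j vQ
    exact ⟨σ, by rw [(splitSetting_regions_of_ne_zero hj vQ).1]; exact image_box_of_perm hσ _⟩
  · refine ⟨swapFamily, swapFamily_mem_indGroup.1, ?_⟩
    rw [(splitSetting_regions_of_ne_zero hj vQ).1, (splitSetting_regions_of_ne_zero hj vQ).2]
    exact (image_box_of_perm (swapFamily_mem_indGroup.2 j vQ) _).symm

/-- The union of the possible images is bounded (inside the shallow box): the hull is defined. [folklore] -/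
theorem splitSetting_sUnion_subset {j : splitIndex.Label} (hj : j ≠ 0) (vQ : splitIndex.VQ) :
    ⋃₀ splitSetting.possibleImages j vQ ⊆ box ∅ := by
  intro x hx
  obtain ⟨U, hU, hxU⟩ := hx
  obtain ⟨σ, rfl⟩ := (splitSetting_possibleImages hj vQ).1 U hU
  exact box_antitone (Finset.empty_subset _) hxU

/-- At the zero label the possible images are all the shallow box (so the union is bounded there too). [folklore] -/
theorem splitSetting_sUnion_subset_zero (vQ : splitIndex.VQ) : ⋃₀ splitSetting.possibleImages 0 vQ ⊆ box ∅ := by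
  intro x hx
  obtain ⟨U, ⟨Φ, hΦ, rfl⟩, hxU⟩ := hx
  obtain ⟨σ, hσ⟩ := actsByPerm_of_mem_closure hΦ 0 vQ
  rw [splitSetting_thetaRegion3, (regionSplit_zero 1 vQ).1, show (box ∅ : Set (splitShells.Packet 0 vQ)) = boxLE 1 ∅ from rfl,
    image_boxLE_of_perm hσ 1 ∅] at hxU
  unfold permD at hxU; rw [Finset.image_empty] at hxU; exact hxU

/-- Every union of possible images admits its hull. [folklore] -/
theorem splitSetting_hullDefined (j : splitIndex.Label) (vQ : splitIndex.VQ) : splitSetting.HullDefined j vQ := by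
  by_cases hj : j = 0
  · subst hj; exact ⟨splitSetting_sUnion_subset_zero vQ, trivial⟩
  · exact ⟨splitSetting_sUnion_subset hj vQ, trivial⟩

/-- **The hull `ⁿ˒°𝒰_{j,v_ℚ}` is the box of the COMMON deep coordinates of the possible images**, and that deep set lies inside
`DTheta j ∩ permD (swapLast j) (DTheta j)`. [folklore] -/
theorem splitSetting_thetaHull {j : splitIndex.Label} (hj : j ≠ 0) (vQ : splitIndex.VQ) :
    splitSetting.thetaHull j vQ = box (deepSet (⋃₀ splitSetting.possibleImages j vQ)) ∧
      deepSet (⋃₀ splitSetting.possibleImages j vQ) ⊆ DTheta j ∩ permD (swapLast j) (DTheta j) := by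
  refine ⟨splitFrame_hull (splitSetting_sUnion_subset hj vQ), fun c hc => Finset.mem_inter.2 ⟨?_, ?_⟩⟩
  · rw [← deepSet_box_DTheta hj vQ, ← (splitSetting_regions_of_ne_zero hj vQ).1]
    exact deepSet_antitone (Set.subset_sUnion_of_mem (splitSetting.thetaRegion3_mem_possibleImages j vQ)) hc
  · have e : deepSet (splitSetting.qRegion j vQ) = permD (swapLast j) (DTheta j) := by
      rw [(splitSetting_regions_of_ne_zero hj vQ).2, ← image_box_of_perm (swapFamily_mem_indGroup.2 j vQ) (DTheta j),
        deepSet_image_of_perm (swapFamily_mem_indGroup.2 j vQ), deepSet_box_DTheta hj]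
    rw [← e]
    exact deepSet_antitone (Set.subset_sUnion_of_mem (splitSetting_possibleImages hj vQ).2) hc

/-- The separating coordinate: `c₀ = 𝟙_{i = 0}` is Θ-deep (`c₀(j) = false` for `j ≥ 1`) but NOT deep for the swapped box. [folklore] -/
theorem DTheta_inter_ssubset {j : splitIndex.Label} (hj : j ≠ 0) : DTheta j ∩ permD (swapLast j) (DTheta j) ⊂ DTheta j := by
  have hj1 : (Fin.last (j : ℕ) : splitIndex.Caps j) ≠ 0 := fun h => by
    have := congrArg Fin.val h
    simp at this
    exact hj this
  let c₀ : splitIndex.Caps j → Bool := fun i => decide (i = 0)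
  have h0 : c₀ ∈ DTheta j := by
    unfold DTheta; rw [Finset.mem_filter]; exact ⟨Finset.mem_univ _, by simp [c₀, hj1]⟩
  have h1 : c₀ ∉ permD (swapLast j) (DTheta j) := by
    rw [mem_permD_iff]; unfold DTheta; rw [Finset.mem_filter]
    simp [c₀, swapLast, Equiv.swap_apply_right]
  exact Finset.ssubset_iff_subset_ne.2 ⟨Finset.inter_subset_left, fun h => h1 (Finset.mem_inter.1 (h.symm ▸ h0)).2⟩

/-- The local q-volume at a label of `𝔽_l^⋇`: `−1 − #DTheta j`. [folklore] -/
theorem splitSetting_qLocal (i : Fin splitIndex.lstar) (vQ : splitIndex.VQ) :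
    splitSetting.qLocal (Setting.labelSucc i) vQ = -1 - ((DTheta (Setting.labelSucc i)).card : ℝ) := by
  have hj := Setting.labelSucc_ne_zero i
  unfold Setting.qLocal
  rw [(splitSetting_regions_of_ne_zero hj vQ).2, ← image_box_of_perm (swapFamily_mem_indGroup.2 _ vQ) (DTheta _)]
  show splitVol _ vQ (swapFamily _ vQ '' box (DTheta _)) = _
  rw [splitVol_image_of_perm (swapFamily_mem_indGroup.2 _ vQ), splitVol_box_DTheta hj]

/-- **The local Θ-volume STRICTLY exceeds the local q-volume at every label of `𝔽_l^⋇`** (the hull's deep set is strictly smaller). [folklore] -/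
theorem splitSetting_qLocal_lt_thetaLocal (i : Fin splitIndex.lstar) (vQ : splitIndex.VQ) :
    splitSetting.qLocal (Setting.labelSucc i) vQ < (splitSetting.thetaLocal (Setting.labelSucc i) vQ).untopD 0 ∧
      splitSetting.thetaLocal (Setting.labelSucc i) vQ ≠ ⊤ := by
  have hj := Setting.labelSucc_ne_zero i
  have e : splitSetting.thetaLocal (Setting.labelSucc i) vQ =
      ((splitVol _ vQ (splitSetting.thetaHull (Setting.labelSucc i) vQ) : ℝ) : WithTop ℝ) := by
    unfold Setting.thetaLocal; rw [if_pos (splitSetting_hullDefined _ vQ)]; rfl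
  refine ⟨?_, by rw [e]; exact WithTop.coe_ne_top⟩
  rw [e, WithTop.untopD_coe, splitSetting_qLocal, (splitSetting_thetaHull hj vQ).1]
  unfold splitVol
  rw [if_pos (box_antitone (Finset.empty_subset _))]
  have hle : (deepSet (box (deepSet (⋃₀ splitSetting.possibleImages (Setting.labelSucc i) vQ)) :
      Set (splitShells.Packet (Setting.labelSucc i) vQ))).card < (DTheta (Setting.labelSucc i)).card := by
    have hsub : deepSet (box (deepSet (⋃₀ splitSetting.possibleImages (Setting.labelSucc i) vQ)) :
        Set (splitShells.Packet (Setting.labelSucc i) vQ)) ⊆ deepSet (⋃₀ splitSetting.possibleImages (Setting.labelSucc i) vQ) :=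
      deepSet_antitone (subset_box_deepSet (splitSetting_sUnion_subset hj vQ))
    exact lt_of_le_of_lt (Finset.card_le_card (hsub.trans (splitSetting_thetaHull hj vQ).2))
      (Finset.card_lt_card (DTheta_inter_ssubset hj))
  have : ((deepSet (box (deepSet (⋃₀ splitSetting.possibleImages (Setting.labelSucc i) vQ)) :
      Set (splitShells.Packet (Setting.labelSucc i) vQ))).card : ℝ) < (DTheta (Setting.labelSucc i)).card := by exact_mod_cast hle
  linarith

/-- `−|log(Θ)|` is finite. [folklore] -/
theorem splitSetting_thetaFinite : splitSetting.ThetaFinite :=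
  ⟨fun i vQ => (splitSetting_qLocal_lt_thetaLocal i vQ).2, fun _ => Set.toFinite _⟩

/-- `−|log(q)| = −4` (`#DTheta 1 = 2`, `#DTheta 2 = 4`: average of `−3` and `−5`). [folklore] -/
theorem splitSetting_absLogQPos : splitSetting.AbsLogQPos := by
  show splitSetting.negLogQ < 0
  unfold Setting.negLogQ processionNormalized
  simp only [finsum_unique, splitSetting_qLocal]
  have h : ∀ i : Fin splitIndex.lstar, (-1 - ((DTheta (Setting.labelSucc i)).card : ℝ)) ≤ -1 := fun i => by
    have : (0 : ℝ) ≤ (DTheta (Setting.labelSucc i)).card := Nat.cast_nonneg _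
    linarith
  have hs : ∑ i : Fin splitIndex.lstar, (-1 - ((DTheta (Setting.labelSucc i)).card : ℝ)) ≤ ∑ _i : Fin splitIndex.lstar, (-1 : ℝ) :=
    Finset.sum_le_sum fun i _ => h i
  have hl : (splitIndex.lstar : ℝ) = 2 := by norm_num [splitIndex]
  rw [hl]
  have : ∑ _i : Fin splitIndex.lstar, (-1 : ℝ) = -2 := by simp [splitIndex]
  linarith

/-- **The printed Statement of Cor. 3.12 HOLDS in P♮₁, STRICTLY** — the hull of the (Ind1)-orbit of the Θ-box is strictly larger than
the q-box at every label of `𝔽_l^⋇`. [folklore] -/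
theorem splitSetting_statement_strict :
    splitSetting.Statement ∧ ((splitSetting.negLogQ : ℝ) : WithTop ℝ) < splitSetting.negLogTheta := by
  have hT := splitSetting.negLogTheta_eq_of_thetaFinite splitSetting_thetaFinite
  have hlt : splitSetting.negLogQ < processionNormalized fun i : Fin splitIndex.lstar =>
      ∑ᶠ vQ : splitIndex.VQ, (splitSetting.thetaLocal (Setting.labelSucc i) vQ).untopD 0 := by
    unfold Setting.negLogQ processionNormalized
    simp only [finsum_unique]
    have hl : (0 : ℝ) < splitIndex.lstar := by norm_num [splitIndex]
    apply div_lt_div_of_pos_right _ hl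
    exact Finset.sum_lt_sum_of_nonempty Finset.univ_nonempty fun i _ => (splitSetting_qLocal_lt_thetaLocal i ()).1
  refine ⟨(splitSetting.statement_iff_real hT).2 hlt.le, ?_⟩
  rw [hT, WithTop.coe_lt_coe]; exact hlt

end SplitWitness

end Summit.ABC.IUTFork.Cor312Vol

end
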